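import Literature.Topology.FourManifolds.BordismFourSignature
import Literature.AlgebraicTopology.SingularHomology.UniversalCoefficientsProofs
import Literature.AlgebraicTopology.SingularHomology.CupProductProofs
import HarnessLib

/-!
# `isOrientedBordant_iff_signature_eq` with the universal-coefficient and cup-commutativity
leaves discharged (Layer 5 of `Literature.Topology.FourManifolds.isOrientedBordant_iff_signature_eq`)

Sibling proof file of `Literature.Topology.FourManifolds.BordismFourSignature`.  There spc4.S36
(`isOrientedBordant_iff_signature_eq`: two closed oriented smooth 4-manifolds are oriented bordant
iff their signatures agree; Thom 1954, Thm IV.1 + Thm IV.13) was proved from twelve hypotheses,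
all textbook theorems vendored as named facts.  Three of them are now theorems of `Literature`:

* `hU1`, universal coefficients, surjectivity of `h : H²(W; ℤ) → Hom(H₂(W; ℤ), ℤ)` (Hatcher
  Thm. 3.2) — `kroneckerMap_surjective_holds` (`…SingularHomology.UniversalCoefficientsProofs`);
* `hU2`, universal coefficients, `ker (h : H² → Hom(H₂, ℤ))` is torsion when `H₁` is finitely
  generated (Hatcher Thm. 3.2 and p. 196) — `ker_kroneckerMap_le_torsion_holds` (same file);
* `hc`, graded commutativity of the cup product (Hatcher Thm. 3.11) —
  `cupProduct_gradedComm_holds` (`…SingularHomology.CupProductProofs`).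

`isOrientedBordant_iff_signature_eq_of_duality` records spc4.S36 from the nine remaining inputs:
Spanier Thm. 6.3.5 (`h635`), Cor. 6.3.10 (`h6310`), Thm. 6.3.12 = Lefschetz duality (`hL`),
Cor. 6.2.21 (`hFW`) for compact 5-manifolds with boundary; Poincaré duality (Hatcher Thm. 3.30,
`hD`) and finiteness of `H²`, `H₂`, `H₁` (Hatcher Cor. A.8–A.9, `hF2`, `hF₂`, `hF₁`) for closed
4-manifolds; and Thom's Thm IV.13 (`h₂`, `Ω⁴ ≅ ℤ` detected by the signature — the converse
direction, a theory of its own).  The forward direction alone (Thom's Thm IV.1, bordism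
invariance of the signature) is recorded from the eight duality/finiteness inputs as
`signature_eq_of_isOrientedBordant_of_duality`.

## References

* R. Thom, *Quelques propriétés globales des variétés différentiables*, Comment. Math. Helv. 28
  (1954), Thm IV.1 (p. 65), Thm IV.13 (p. 81). [ThomCMH1954]
* R. Thom, *Espaces fibrés en sphères et carrés de Steenrod*, Ann. Sci. ENS 69 (1952), Cor. V.8
  (p. 173), Cor. V.11 (p. 176). [Thom1952]
* A. Hatcher, *Algebraic Topology*, CUP 2002, Thm. 3.2, Thm. 3.11, Thm. 3.30, Cor. A.8–A.9. [Hatcher2002]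
* E. H. Spanier, *Algebraic Topology*, Springer 1981, Ch. 6 §2 Cor. 21, §3 Thm. 5, Cor. 10, Thm. 12. [Spanier1981]
-/

noncomputable section

open scoped Manifold ContDiff Topology

universe u

namespace Literature.Topology.FourManifolds

section SPC4

/-- **Thom's Thm IV.1 in dimension four (bordism invariance of the signature) from duality and
finiteness alone**: if `(M, μ)` and `(N, ν)` are oriented bordant then `σ(M, μ) = σ(N, ν)`, given
Spanier Thm. 6.3.5 (`h635`), Cor. 6.3.10 (`h6310`), Lefschetz duality Thm. 6.3.12 (`hL`),
finiteness Cor. 6.2.21 (`hFW`) for compact 5-manifolds with boundary, and Poincaré duality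
(`hD`) and finiteness of `H²`, `H₂`, `H₁` (`hF2`, `hF₂`, `hF₁`) for closed 4-manifolds;
universal coefficients and graded commutativity of `⌣` are now theorems
(`kroneckerMap_surjective_holds`, `ker_kroneckerMap_le_torsion_holds`,
`cupProduct_gradedComm_holds`).  PROVED. [cite: ThomCMH1954, Thm IV.1 (p. 65)] -/
theorem signature_eq_of_isOrientedBordant_of_duality
    (h635 : ∀ {W : Type u} [TopologicalSpace W] [T2Space W] [CompactSpace W] [ConnectedSpace W]
      [ChartedSpace (EuclideanHalfSpace (4 + 1)) W]
      (h : ∃ z : ↥(Literature.AlgebraicTopology.SingularHomology.relativeSingularHomology ℤ ℤ W ((𝓡∂ (4 + 1)).boundary W) (4 + 1)), z ≠ 0),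
      Literature.AlgebraicTopology.SingularHomology.relativeSingularHomology.exists_linearEquiv_of_ne_zero ℤ 4 W h)
    (h6310 : ∀ {W : Type u} [TopologicalSpace W] [T2Space W] [CompactSpace W]
      [ChartedSpace (EuclideanHalfSpace (4 + 1)) W]
      (z : ↥(Literature.AlgebraicTopology.SingularHomology.relativeSingularHomology ℤ ℤ W ((𝓡∂ (4 + 1)).boundary W) (4 + 1)))
      (hz : Literature.AlgebraicTopology.SingularHomology.IsRelFundamentalClass ℤ ((𝓡∂ (4 + 1)).boundary W) z),
      Literature.AlgebraicTopology.SingularHomology.isGenerator_toLocal_δ_of_isRelFundamentalClass ℤ 4 W z hz)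
    (hL : ∀ {W : Type u} [TopologicalSpace W] [T2Space W] [CompactSpace W]
      [ChartedSpace (EuclideanHalfSpace (4 + 1)) W]
      (z : ↥(Literature.AlgebraicTopology.SingularHomology.relativeSingularHomology ℤ ℤ W ((𝓡∂ (4 + 1)).boundary W) (4 + 1)))
      (hz : Literature.AlgebraicTopology.SingularHomology.IsRelFundamentalClass ℤ ((𝓡∂ (4 + 1)).boundary W) z),
      Literature.AlgebraicTopology.SingularHomology.bijective_relCapProduct_of_isRelFundamentalClass ℤ 4 W z hz (show 2 + (2 + 1) = 4 + 1 by rfl))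
    (hFW : ∀ {W : Type u} [TopologicalSpace W] [T2Space W] [CompactSpace W]
      [ChartedSpace (EuclideanHalfSpace (4 + 1)) W]
      (z : ↥(Literature.AlgebraicTopology.SingularHomology.relativeSingularHomology ℤ ℤ W ((𝓡∂ (4 + 1)).boundary W) (4 + 1)))
      (hz : Literature.AlgebraicTopology.SingularHomology.IsRelFundamentalClass ℤ ((𝓡∂ (4 + 1)).boundary W) z),
      Literature.AlgebraicTopology.SingularHomology.finite_singularHomology_of_isRelFundamentalClass ℤ 4 W z hz 2)
    (hD : ∀ {P : Type u} [TopologicalSpace P] [T2Space P] [CompactSpace P]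
      [ChartedSpace (EuclideanSpace ℝ (Fin 4)) P] (π : Literature.AlgebraicTopology.SingularHomology.HomologicalOrientation ℤ P 4),
      Literature.AlgebraicTopology.SingularHomology.bijective_poincareDualityMap π two_add_two_eq_four)
    (hF2 : ∀ {P : Type u} [TopologicalSpace P] [T2Space P] [CompactSpace P]
      [ChartedSpace (EuclideanSpace ℝ (Fin 4)) P], Literature.AlgebraicTopology.SingularHomology.finite_singularCohomology_of_compactSpace ℤ P 4 2)
    (hF₂ : ∀ {P : Type u} [TopologicalSpace P] [T2Space P] [CompactSpace P]
      [ChartedSpace (EuclideanSpace ℝ (Fin 4)) P], Literature.AlgebraicTopology.SingularHomology.finite_singularHomology_of_compactSpace ℤ P 4 2)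
    (hF₁ : ∀ {P : Type u} [TopologicalSpace P] [T2Space P] [CompactSpace P]
      [ChartedSpace (EuclideanSpace ℝ (Fin 4)) P], Literature.AlgebraicTopology.SingularHomology.finite_singularHomology_of_compactSpace ℤ P 4 1) :
    signature_eq_of_isOrientedBordant.{u} :=
  signature_eq_of_isOrientedBordant_of_boundaryImageRank
    (two_mul_boundaryImageRank_eq_of_facts h635 h6310 hL hFW
      (fun {W} _ => Literature.AlgebraicTopology.SingularHomology.kroneckerMap_surjective_holds ℤ W 2)
      (fun {X} _ => @Literature.AlgebraicTopology.SingularHomology.ker_kroneckerMap_le_torsion_holds ℤ _ _ _ X _ 1)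
      hD hF2 hF₂ hF₁)
    (fun π => sigPos_add_sigNeg_intersectionForm_four_of_facts π (hD π)
      (Literature.AlgebraicTopology.SingularHomology.kroneckerMap_surjective_holds ℤ _ 2)
      (@Literature.AlgebraicTopology.SingularHomology.ker_kroneckerMap_le_torsion_holds ℤ _ _ _ _ _ 1) hF2 hF₁
      (Literature.AlgebraicTopology.SingularHomology.cupProduct_gradedComm_holds ℤ _))
    hF2

/-- **spc4.S36 (`isOrientedBordant_iff_signature_eq`) from duality, finiteness and Thom's
Thm IV.13**: as `isOrientedBordant_iff_signature_eq_of_facts'`, with the universal-coefficient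
hypotheses `hU1`, `hU2` (Hatcher Thm. 3.2) and graded commutativity `hc` (Hatcher Thm. 3.11) now
discharged by `kroneckerMap_surjective_holds`, `ker_kroneckerMap_le_torsion_holds` and
`cupProduct_gradedComm_holds`.  Remaining inputs: Spanier Thm. 6.3.5 (`h635`), Cor. 6.3.10
(`h6310`), Thm. 6.3.12 (`hL`), Cor. 6.2.21 (`hFW`); Hatcher Thm. 3.30 (`hD`), Cor. A.8–A.9
(`hF2`, `hF₂`, `hF₁`); Thom's Thm IV.13 (`h₂`).  PROVED.
[cite: ThomCMH1954, Thm IV.1 (p. 65) and Thm IV.13 (p. 81)] -/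
theorem isOrientedBordant_iff_signature_eq_of_duality
    (h635 : ∀ {W : Type u} [TopologicalSpace W] [T2Space W] [CompactSpace W] [ConnectedSpace W]
      [ChartedSpace (EuclideanHalfSpace (4 + 1)) W]
      (h : ∃ z : ↥(Literature.AlgebraicTopology.SingularHomology.relativeSingularHomology ℤ ℤ W ((𝓡∂ (4 + 1)).boundary W) (4 + 1)), z ≠ 0),
      Literature.AlgebraicTopology.SingularHomology.relativeSingularHomology.exists_linearEquiv_of_ne_zero ℤ 4 W h)
    (h6310 : ∀ {W : Type u} [TopologicalSpace W] [T2Space W] [CompactSpace W]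
      [ChartedSpace (EuclideanHalfSpace (4 + 1)) W]
      (z : ↥(Literature.AlgebraicTopology.SingularHomology.relativeSingularHomology ℤ ℤ W ((𝓡∂ (4 + 1)).boundary W) (4 + 1)))
      (hz : Literature.AlgebraicTopology.SingularHomology.IsRelFundamentalClass ℤ ((𝓡∂ (4 + 1)).boundary W) z),
      Literature.AlgebraicTopology.SingularHomology.isGenerator_toLocal_δ_of_isRelFundamentalClass ℤ 4 W z hz)
    (hL : ∀ {W : Type u} [TopologicalSpace W] [T2Space W] [CompactSpace W]
      [ChartedSpace (EuclideanHalfSpace (4 + 1)) W]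
      (z : ↥(Literature.AlgebraicTopology.SingularHomology.relativeSingularHomology ℤ ℤ W ((𝓡∂ (4 + 1)).boundary W) (4 + 1)))
      (hz : Literature.AlgebraicTopology.SingularHomology.IsRelFundamentalClass ℤ ((𝓡∂ (4 + 1)).boundary W) z),
      Literature.AlgebraicTopology.SingularHomology.bijective_relCapProduct_of_isRelFundamentalClass ℤ 4 W z hz (show 2 + (2 + 1) = 4 + 1 by rfl))
    (hFW : ∀ {W : Type u} [TopologicalSpace W] [T2Space W] [CompactSpace W]
      [ChartedSpace (EuclideanHalfSpace (4 + 1)) W]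
      (z : ↥(Literature.AlgebraicTopology.SingularHomology.relativeSingularHomology ℤ ℤ W ((𝓡∂ (4 + 1)).boundary W) (4 + 1)))
      (hz : Literature.AlgebraicTopology.SingularHomology.IsRelFundamentalClass ℤ ((𝓡∂ (4 + 1)).boundary W) z),
      Literature.AlgebraicTopology.SingularHomology.finite_singularHomology_of_isRelFundamentalClass ℤ 4 W z hz 2)
    (hD : ∀ {P : Type u} [TopologicalSpace P] [T2Space P] [CompactSpace P]
      [ChartedSpace (EuclideanSpace ℝ (Fin 4)) P] (π : Literature.AlgebraicTopology.SingularHomology.HomologicalOrientation ℤ P 4),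
      Literature.AlgebraicTopology.SingularHomology.bijective_poincareDualityMap π two_add_two_eq_four)
    (hF2 : ∀ {P : Type u} [TopologicalSpace P] [T2Space P] [CompactSpace P]
      [ChartedSpace (EuclideanSpace ℝ (Fin 4)) P], Literature.AlgebraicTopology.SingularHomology.finite_singularCohomology_of_compactSpace ℤ P 4 2)
    (hF₂ : ∀ {P : Type u} [TopologicalSpace P] [T2Space P] [CompactSpace P]
      [ChartedSpace (EuclideanSpace ℝ (Fin 4)) P], Literature.AlgebraicTopology.SingularHomology.finite_singularHomology_of_compactSpace ℤ P 4 2)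
    (hF₁ : ∀ {P : Type u} [TopologicalSpace P] [T2Space P] [CompactSpace P]
      [ChartedSpace (EuclideanSpace ℝ (Fin 4)) P], Literature.AlgebraicTopology.SingularHomology.finite_singularHomology_of_compactSpace ℤ P 4 1)
    (h₂ : isOrientedBordant_of_signature_eq.{u}) : isOrientedBordant_iff_signature_eq.{u} :=
  isOrientedBordant_iff_signature_eq_of_facts' h635 h6310 hL hFW
    (fun {W} _ => Literature.AlgebraicTopology.SingularHomology.kroneckerMap_surjective_holds ℤ W 2)
    (fun {X} _ => @Literature.AlgebraicTopology.SingularHomology.ker_kroneckerMap_le_torsion_holds ℤ _ _ _ X _ 1)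
    hD hF2 hF₂ hF₁
    (fun {P} _ => Literature.AlgebraicTopology.SingularHomology.cupProduct_gradedComm_holds ℤ P) h₂

end SPC4

end Literature.Topology.FourManifolds

end
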